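import Summits.BirchSwinnertonDyer.BirchSwinnertonDyer.Theses.SignedLowerHalves
import Summits.BirchSwinnertonDyer.Rank1Residual.Supersingular.KobayashiMainConjecture
import Summits.BirchSwinnertonDyer.Rank1Residual.Supersingular.KobayashiConverseReal
import Summits.BirchSwinnertonDyer.Rank1Residual.Supersingular.X7KolyvaginRoadSupersingular
import Summits.BirchSwinnertonDyer.Rank1Residual.Supersingular.X7ToricPeriodUnitConsumer
import Literature.NumberTheory.EllipticCurves.Rank1Residual.Typed.X7
import HarnessLib

/-!
# Line `toric-oddvertex` — crux `KobayashiLowerHalfLargeImage` (route SignedLowerHalves, item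
# stmt-BirchSwinnertonDyer-19001, rank 3): a DECIDABLE ODD-VERTEX TORIC CERTIFICATE over a Heegner field,
# plus bipartite rigidity (Howard 2006 odd type / C.-H. Kim 2024 "higher Waldspurger"), supplies the
# classical lower bound on `#Ш` EXACTLY (as an index identity) on `X7 ∧ r_an = 1`; the rank-`0` branch
# reuses the tree's own `(A3)` avatar `X7.ToricPeriodUnitAt` and its kernel consumer.

HONEST FRAMING (D-0152). This line feeds the CLASS route K3 = `SignedLowerHalves`, whose `closes` reaches
the rung leaf `SignedSupersingular`; the crux is consumed only at `r_an ≤ 1`; NOTHING here proves BSD.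
Every `stub_*` is `sorry`; the composition `KobayashiLowerHalfLargeImage_of` only shows that the stubs,
if proved, give the crux BY NAME. Ideation artefact (crux-ideate k2 g9): NOT registered with
`ledger skeleton check` (W-79: the line of record stays `Lines/kurihara_rigidity.lean`).

LEVER (one sentence). For a rank-one X7 pair `(E,p)` and a Heegner field `K` (every `ℓ ∣ N` split,
`p` split, `L(E^{(d_K)},1) ≠ 0`), ONE mod-`p` Brandt-module computation at ONE odd admissible vertex
`n = ℓ₁⋯ℓ_{2j+1}` — the toric period `λ_K(n) = Σ_σ fₙ(x_σ)` of the level-raised mod-`p` eigenfunction on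
the definite quaternion algebra of discriminant `n` with Eichler level `N` (non-square-free `N` is fine:
the algebra is split at every `q ∣ N`) — is a CERTIFICATE `λ_K(n) ≢ 0 (mod p)`; bipartite rigidity turns
it into `length Ш(E/K)[p^∞] = 2·ord_p[E(K)⊗ℤ_p : ℤ_p·y_K] − 2·ord_p ∏c_ℓ` (the Heegner index IDENTITY,
`X11b.IndexIdentityAt`), whence the tree's road `X7.missingLowerBoundAt_of_stepL_of_surj` gives
`MissingLowerBoundAt W p`, and an `r_an = 1` lift gives the Eisenstein half.

WHY THIS IS NOT ROAD K AGAIN. Road K (`ZhangKolyvaginNonvanishingSS`) wants the non-vanishing of a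
KOLYVAGIN class `c(n) mod p` class-wide, whose only printed source is the converse/atom; Kolyvagin
classes live over ring class fields of conductor `n` and are not machine-checkable in practice. The odd
vertex certificate is a finite linear-algebra datum (Brandt matrices at level `(N, n)`, a Gross point,
one sum), exactly like the 77/77 Kurihara certificates of kit j296231 on the Kato side: per pair it is
DECIDED, class-wide it is the primitivity of the Heegner-base bipartite Euler system (Howard's
"`λ ≠ 0`", = Kolyvagin's conjecture in Bertolini–Darmon form) — a NAMED open statement with the same
epistemic status as Kim's Conjecture 1.10 in the line of record, on the OTHER Euler system.

STUBS (7; sizes in the line card):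
* `stub_oddVertexCertificate_rankOne` — HARD / per-pair decidable: the certificate exists at every
  Heegner `K` with `p` split and `r_an(E^{(d_K)}) = 0`, on `X7 ∧ Surj ∧ p ≥ 5 ∧ r_an = 1`.
* `stub_indexIdentity_of_oddVertexCertificate` — ENGINE (rigidity): certificate ⇒ `X11b.IndexIdentityAt`
  at a Manin-unit Heegner datum. Printed for the DEFINITE base (Kim 2024 = arXiv:2203.12161 Thm. 2.5,
  slope-free, `N⁺` arbitrary) and Λ-adically for the indefinite base at ordinary `p` (Howard 2006
  Thm. 3.2.3); the finite-level indefinite-base reading at `a_p = 0` is a TRANSPLANT (size M).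
* `stub_missingLowerBound_of_indexIdentity` — KERNEL-CLOSABLE modulo the road's nine named published
  facts (`hGZ hKo hWu hGZK hmod hnf hFH hMaz hNS` of `X7.missingLowerBoundAt_of_stepL_of_surj`): the
  identity implies STEP L (`omega`), torsion Heegner points make STEP L vacuous.
* `stub_lift_rankOne` — OPEN (shared in shape with `crossing_rigidity.stub_lift_rankOne`, minus its
  twist hypothesis): `MissingLowerBoundAt ⇒` Eisenstein half at `r_an = 1` (signed leading term).
* `stub_rankZero_of_toricPeriodUnit` — KERNEL-CLOSABLE modulo named facts and the side conditions of
  `X7.bsdp_of_toricPeriodUnitAt_of_analyticRank_eq_zero` (optimal curve, Manin unit, `p ∤ ∏c`), then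
  `X7.kobayashiMainConjecture_of_bsdp_of_analyticRank_eq_zero` + `kobayashiLowerDivisibility_of_mainConjecture`.
* `stub_toricPeriodUnit_rankZero` — HARD / per-pair decidable: the tree's `(A3)` typed input on the
  corner at `r_an = 0` for curves with a multiplicative prime (a definite `K` needs one).
* `stub_residues` — NOT claimed by the lever, recorded honestly: `p = 3` (`NoAdmissiblePrimesAtThree`),
  `r_an ≥ 2` (cone-idle: `closes` never instantiates it), `r_an = 0` without a multiplicative prime
  (K1G7 note 5 `PurePSSignMinusOne`).
Vendored vocabulary (advisory, 2 decls, nothing asserted): `OddVertexToricUnitData`, `OddVertexToricUnitAt`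
— the odd-vertex / Heegner-base twin of the tree's `X7.ToricPeriodUnitData` / `X7.ToricPeriodUnitAt`,
over the SAME Brandt vocabulary (`Brandt.XiSetup`, `Brandt.IsGrossPoint`, `Brandt.toricPeriod`).

References: [Howard2006Bipartite] = B. Howard, Bipartite Euler systems, J. reine angew. Math. 597 (2006),
Thm. 3.2.3; [Kim2024] = C.-H. Kim, arXiv:2203.12161 (TAMS 377 (2024)) Thm. 2.5, Rem. 2.1, §4;
[BertoliniDarmon2005] §§2–4; [WZhang2014] §6; [GrossZagier1986]; [Kobayashi2003]; [BDKim2013] Cor. 3.15.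
-/

set_option autoImplicit false

noncomputable section

open scoped Classical Matrix MatrixGroups ModularForm

open CongruenceSubgroup WeierstrassCurve NumberField Literature.NumberTheory.EllipticCurves
  Literature.NumberTheory.EllipticCurves.ModularForms
  Literature.NumberTheory.EllipticCurves.Rank1Residual
  Literature.NumberTheory.EllipticCurves.Rank1Residual.Typed
  Literature.NumberTheory.Automorphic
  Literature.NumberTheory.QuadraticFields
  Summit.BirchSwinnertonDyer.Rank1Residual
  Summit.BirchSwinnertonDyer.Rank1Residual.Supersingular

namespace Summit.BirchSwinnertonDyer.BirchSwinnertonDyer.Cruxes.KobayashiLowerHalfLargeImage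

namespace ToricOddVertex

/-- (vendored vocabulary, advisory — nothing asserted) **The odd-vertex toric certificate data over a
Heegner field.** `K` imaginary quadratic satisfying the Heegner hypothesis for `N = cond(E)` with `p`
split; `n` a square-free product of an ODD number of `1`-admissible primes (Bertolini–Darmon:
`q ∤ Np`, `q` inert, `p ∤ q² − 1`, `a_q ≡ ±(q+1) (mod p)`); `Sₙ` a Brandt set-up of type `(N, n)` (the
DEFINITE quaternion algebra of discriminant `n`, Eichler level `N` — split at every `q ∣ N`, so
non-square-free `N` is allowed); `ψₙ` a Gross point of `Sₙ.O`; `fₙ` THE level-raised mod-`p`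
eigenfunction (`T_q ↦ a_q(E)` for `q ∤ Nn`, alone on its line); and the CERTIFICATE: its toric period
`λ_K(n) = Σ_σ fₙ(σ·xₙ)` is non-zero in `𝔽_p`. The Heegner-base twin of `X7.ToricPeriodUnitData`.
[cite: BertoliniDarmon2005, §2.2 (admissible primes), §§3–4 (shape only; nothing asserted)]
[cite: Kim2024, §2.4, §5.2 (shape only; nothing asserted)] -/
structure OddVertexToricUnitData (W : WeierstrassCurve ℚ) (p : ℕ) (K : Type) [Field K]
    [NumberField K] (N n : ℕ) (Sₙ : Brandt.XiSetup N n) [Fintype (Brandt.ClassSet Sₙ.O)]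
    (ψₙ : K →ₐ[ℚ] Sₙ.D) (fₙ : Brandt.ClassSet Sₙ.O → ZMod p) : Prop where
  /-- `N` is the conductor of `E`. -/
  conductor_eq : W.conductorNorm ℤ = N
  /-- `K` is imaginary quadratic … -/
  imagQuad : IsImaginaryQuadratic K
  /-- … every `ℓ ∣ N` splits in `K` (Heegner hypothesis, all of `N` in `N⁺`) … -/
  heegner : SatisfiesHeegnerHypothesis N K
  /-- … and `p` splits in `K`. -/
  split : SatisfiesHeegnerHypothesis p K
  /-- `n` is square-free … -/
  squarefree_n : Squarefree n
  /-- … with an ODD number of prime factors (an odd vertex of the Heegner-base bipartite system) … -/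
  odd_n : Odd n.primeFactors.card
  /-- … each `1`-admissible: `q ∤ Np`, `q` inert in `K`, `p ∤ q² − 1`, `a_q ≡ ±(q+1) (mod p)`. -/
  admissible : ∀ q ∈ n.primeFactors, ¬ q ∣ N * p ∧
    (((Ideal.span {(q : ℤ)}).primesOver (𝓞 K)).ncard ≠ 2 ∧ ¬ (q : ℤ) ∣ NumberField.discr K) ∧
    ¬ (p : ℤ) ∣ (q : ℤ) ^ 2 - 1 ∧
    ((p : ℤ) ∣ W.LFunction q - (q + 1) ∨ (p : ℤ) ∣ W.LFunction q + (q + 1))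
  /-- `ψₙ` is a Gross point (optimal embedding of `𝓞_K`) of `Sₙ.O`. -/
  grossPointₙ : Brandt.IsGrossPoint Sₙ.O ψₙ Sₙ.O
  /-- `fₙ ≠ 0` … -/
  fₙ_ne_zero : fₙ ≠ 0
  /-- … is a mod-`p` Hecke eigenfunction at level `(N, n)` with the eigenvalues of `E` away from `Nn` … -/
  fₙ_eigen : ∀ q : ℕ, q.Prime → ¬ q ∣ N * n →
    fₙ ᵥ* (Brandt.matrix Sₙ.O q).map (Int.cast : ℤ → ZMod p) = ((W.LFunction q : ℤ) : ZMod p) • fₙ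
  /-- … alone on its eigen-line (multiplicity one mod `p`: the level-raised form). -/
  fₙ_alone : ∀ g : Brandt.ClassSet Sₙ.O → ZMod p,
    (∀ q : ℕ, q.Prime → ¬ q ∣ N * n →
      g ᵥ* (Brandt.matrix Sₙ.O q).map (Int.cast : ℤ → ZMod p) = ((W.LFunction q : ℤ) : ZMod p) • g) →
    ∃ a : ZMod p, g = a • fₙ
  /-- THE CERTIFICATE: the toric period `λ_K(n)` is a unit (`≠ 0` in `𝔽_p`). -/
  toricPeriodₙ_ne_zero : Brandt.toricPeriod Sₙ.O ψₙ Sₙ.O fₙ ≠ 0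

/-- (vendored vocabulary, advisory — nothing asserted) **`OddVertexToricUnitAt W p K`: SOME odd-vertex
toric certificate over the Heegner field `K` exists** — a level `n`, a Brandt set-up, a Gross point and
the level-raised mod-`p` eigenfunction with a UNIT toric period. Per pair and per candidate `n` a finite
computation; class-wide (on X7 ∧ `r_an = 1`) the primitivity of the Heegner-base bipartite Euler system. -/
def OddVertexToricUnitAt (W : WeierstrassCurve ℚ) (p : ℕ) (K : Type) [Field K] [NumberField K] :
    Prop :=
  ∃ (N n : ℕ) (Sₙ : Brandt.XiSetup N n) (_ : Fintype (Brandt.ClassSet Sₙ.O)) (ψₙ : K →ₐ[ℚ] Sₙ.D)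
    (fₙ : Brandt.ClassSet Sₙ.O → ZMod p), OddVertexToricUnitData W p K N n Sₙ ψₙ fₙ

/-- STUB 1 — HARD, per pair DECIDABLE (the certificate). On `X7 ∧ Surj ∧ p ≥ 5 ∧ r_an(E) = 1`, for every
Heegner field `K` of `E` with `p` split and `r_an(E^{(d_K)}) = 0`, some odd admissible vertex carries a
unit toric period. Class-wide = primitivity of the Heegner-base bipartite Euler system (`λ ≢ 0`), i.e.
Kolyvagin's conjecture in Bertolini–Darmon form — OPEN at a non-ordinary `p` of non-square-free level;
for ONE pair it is decided by a Brandt-module computation at level `(N, ℓ₁ℓ₂ℓ₃)`.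
[cite: Howard2006Bipartite, Thm. 3.2.3 (b)⇒(c) shape] [cite: Kim2024, §2.5 and Thm. 2.2] -/
theorem stub_oddVertexCertificate_rankOne :
    ∀ (W : WeierstrassCurve ℚ) [W.IsElliptic] [W.IsGloballyMinimal] (p : ℕ) [Fact p.Prime]
      (N : ℕ) [NeZero N] (K : Type) [Field K] [NumberField K],
      5 ≤ p → ClassX7 W p → Surj W p → W.analyticRank = 1 → W.conductorNorm ℤ = N →
      IsImaginaryQuadratic K → SatisfiesHeegnerHypothesis N K → SatisfiesHeegnerHypothesis p K →
      (W.quadraticTwist (NumberField.discr K : ℚ)).analyticRank = 0 →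
      OddVertexToricUnitAt W p K := by
  sorry

/-- STUB 2 — ENGINE (bipartite rigidity, "higher Waldspurger" read on the Heegner base). A unit toric
period at ONE odd vertex forces `∂^(∞) = 0` for the Heegner-base bipartite system, and then the finite-level
structure theorem gives `length_{ℤ_p} Ш(E/K)[p^∞] = 2·ord_p[E(K)⊗ℤ_p : ℤ_p·y_K]` corrected by the
split Tamagawa numbers — the Heegner index IDENTITY at a Manin-unit Heegner datum. In print: definite
base, any reduction type with `ρ̄` onto and `p ≥ 5` (Kim 2024 Thm. 2.5, `N⁺` arbitrary); indefinite base
Λ-adically at ordinary `p` (Howard 2006 Thm. 3.2.3). The finite-level indefinite-base case at `a_p = 0`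
is a TRANSPLANT of Kim's §4 (his Remark 2.1: the formalism is slope-free). Size M.
[cite: Kim2024, Thm. 2.5, Rem. 2.1] [cite: Howard2006Bipartite, Thm. 3.2.3] [cite: GrossZagier1986, V.(2.2)] -/
theorem stub_indexIdentity_of_oddVertexCertificate :
    ∀ (W : WeierstrassCurve ℚ) [W.IsElliptic] [W.IsGloballyMinimal] (p : ℕ) [Fact p.Prime]
      (N : ℕ) [NeZero N] (K : Type) [Field K] [NumberField K]
      (Dt : ModularParametrizationData W N) (H : HeegnerDatum N (NumberField.discr K)) (ι : K →+* ℂ)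
      (P : (W.baseChange K).toAffine.Point),
      ClassX7 W p → Surj W p → 5 ≤ p → W.analyticRank = 1 → W.conductorNorm ℤ = N →
      IsImaginaryQuadratic K → SatisfiesHeegnerHypothesis N K → SatisfiesHeegnerHypothesis p K →
      WeierstrassCurve.Affine.Point.map ι.toRatAlgHom P = heegnerPointComplex Dt H →
      ¬ (p : ℤ) ∣ Dt.c → (W.quadraticTwist (NumberField.discr K : ℚ)).analyticRank = 0 →
      OddVertexToricUnitAt W p K → X11b.IndexIdentityAt W p K P := by
  sorry

/-- STUB 3 — KERNEL-CLOSABLE modulo the road's named published facts. If the index identity holds at every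
Manin-unit Heegner datum with `p` split and `r_an(E^{(d_K)}) = 0`, then `MissingLowerBoundAt W p` on
`X7 ∧ Surj ∧ p ≥ 5 ∧ r_an = 1`: the identity gives STEP L `X11b.IndexLowerBoundAt` (`omega`); at a datum
with `r_an(E^{(d_K)}) ≥ 2` the Heegner point is torsion (Gross–Zagier) and STEP L is vacuous
(`index = 0`); then `X7.missingLowerBoundAt_of_stepL_of_surj` (inputs `hGZ hKo hWu hGZK hmod hnf hFH hMaz
hNS`, all named facts of the tree). Size S. -/
theorem stub_missingLowerBound_of_indexIdentity :
    (∀ (W : WeierstrassCurve ℚ) [W.IsElliptic] [W.IsGloballyMinimal] (p : ℕ) [Fact p.Prime]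
      (N : ℕ) [NeZero N] (K : Type) [Field K] [NumberField K]
      (Dt : ModularParametrizationData W N) (H : HeegnerDatum N (NumberField.discr K)) (ι : K →+* ℂ)
      (P : (W.baseChange K).toAffine.Point),
      ClassX7 W p → Surj W p → 5 ≤ p → W.analyticRank = 1 → W.conductorNorm ℤ = N →
      IsImaginaryQuadratic K → SatisfiesHeegnerHypothesis N K → SatisfiesHeegnerHypothesis p K →
      WeierstrassCurve.Affine.Point.map ι.toRatAlgHom P = heegnerPointComplex Dt H →
      ¬ (p : ℤ) ∣ Dt.c → (W.quadraticTwist (NumberField.discr K : ℚ)).analyticRank = 0 →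
      X11b.IndexIdentityAt W p K P) →
    ∀ (W : WeierstrassCurve ℚ) [W.IsElliptic] [W.IsGloballyMinimal] (p : ℕ) [Fact p.Prime],
      ClassX7 W p → Surj W p → 5 ≤ p → W.analyticRank = 1 → MissingLowerBoundAt W p := by
  sorry

/-- STUB 4 — OPEN (the `r_an = 1` lift; shared in shape with `crossing_rigidity.stub_lift_rankOne`, without
its twist hypothesis). From `ord_p #Ш_an(E) ≤ ord_p #Ш(E)` at an X7 pair of analytic rank one to the
Eisenstein half of Kobayashi's signed main conjecture (one sign suffices): Kato–Kobayashi upper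
divisibility + comparison of `T`-adic leading terms (B.D. Kim 2013 for the algebraic side, Kobayashi's
signed `p`-adic Gross–Zagier for the analytic side) when the signed `p`-adic height of the generator is
non-degenerate; or the crossing-value rigidity over `K_∞⁺` of line `crossing-rigidity`. NOT the
calibration fact PerrinRiou2003 Prop. 4.20 (never an input). Size L.
[cite: Kobayashi2003, Thm. 1.3] [cite: BDKim2013, Cor. 3.15] -/
theorem stub_lift_rankOne :
    ∀ (W : WeierstrassCurve ℚ) [W.IsElliptic] [W.IsGloballyMinimal] (p : ℕ) [Fact p.Prime],
      5 ≤ p → ClassX7 W p → ¬ W.HasCM → W.frobeniusTrace p = 0 → Surj W p →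
      W.analyticRank = 1 → MissingLowerBoundAt W p →
      ∃ ε : ℤˣ, KobayashiLowerDivisibility W p ε := by
  sorry

/-- STUB 5 — KERNEL-CLOSABLE modulo named facts (the rank-`0` consumer of the tree's `(A3)` avatar).
`X7.ToricPeriodUnitAt W p` at an X7 pair with `r_an = 0`, `p ≥ 5`, `ρ̄` onto gives `BSD(E,p)`
(`X7.bsdp_of_toricPeriodUnitAt_of_analyticRank_eq_zero`: Kim 2024 Thm. 5.23, Cai–Shu–Tian, W. Zhang 6.4,
ARS, GZK, modularity, Wuthrich Prop. 21 — under its side conditions: optimal curve with Manin constant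
prime to `p`, `p ∤ ∏c_ℓ(E)`; the remaining isogeny/Tamagawa bookkeeping is support, MEMO-5 of seat lev),
then `X7.kobayashiMainConjecture_of_bsdp_of_analyticRank_eq_zero` and
`kobayashiLowerDivisibility_of_mainConjecture`. Size S–M (bookkeeping). -/
theorem stub_rankZero_of_toricPeriodUnit :
    ∀ (W : WeierstrassCurve ℚ) [W.IsElliptic] [W.IsGloballyMinimal] (p : ℕ) [Fact p.Prime],
      5 ≤ p → ClassX7 W p → ¬ W.HasCM → W.frobeniusTrace p = 0 → Surj W p →
      W.analyticRank = 0 → X7.ToricPeriodUnitAt W p →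
      ∃ ε : ℤˣ, KobayashiLowerDivisibility W p ε := by
  sorry

/-- STUB 6 — HARD, per pair DECIDABLE (the even-vertex certificate = the tree's `(A3)` typed input, read
on the corner). An X7 pair with `r_an = 0`, `p ≥ 5`, `ρ̄` onto and at least one prime of multiplicative
reduction (needed to place an odd number of primes in `N⁻`: a definite `K`) admits definite data with a
unit level-raised toric period. Class-wide OPEN (primitivity of the definite bipartite family); per pair
one Brandt module at level `(N⁺, N⁻n)`. [cite: Kim2024, Thm. 5.23 and §2.5 (shape)] -/
theorem stub_toricPeriodUnit_rankZero :
    ∀ (W : WeierstrassCurve ℚ) [W.IsElliptic] [W.IsGloballyMinimal] (p : ℕ) [Fact p.Prime],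
      5 ≤ p → ClassX7 W p → ¬ W.HasCM → W.frobeniusTrace p = 0 → Surj W p →
      W.analyticRank = 0 → (∃ (ℓ : ℕ) (_ : Fact ℓ.Prime), W.HasMultiplicativeReductionAtPrime ℓ) →
      X7.ToricPeriodUnitAt W p := by
  sorry

/-- STUB 7 — RESIDUES, NOT claimed by the lever (recorded so the composition is honest): `p = 3`
(`Literature.Barriers.BirchSwinnertonDyer.NoAdmissiblePrimesAtThree`: no admissible primes, no bipartite
system); `r_an ≥ 2` (cone-idle: the route's `closes` never instantiates the crux there); `r_an = 0`
without a multiplicative prime (no definite `K` unless a supercuspidal prime is made inert — K1G7 note 5).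
Shared with every Kolyvagin/bipartite line on this crux. -/
theorem stub_residues :
    ∀ (W : WeierstrassCurve ℚ) [W.IsElliptic] [W.IsGloballyMinimal] (p : ℕ) [Fact p.Prime],
      p ≠ 2 → ClassX7 W p → ¬ W.HasCM → W.frobeniusTrace p = 0 → Surj W p →
      (p = 3 ∨ 2 ≤ W.analyticRank ∨
        (W.analyticRank = 0 ∧ ¬ ∃ (ℓ : ℕ) (_ : Fact ℓ.Prime), W.HasMultiplicativeReductionAtPrime ℓ)) →
      ∃ ε : ℤˣ, KobayashiLowerDivisibility W p ε := by
  sorry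

/-- COMPOSITION (kernel-checked, no `sorry` of its own): from the seven stub STATEMENTS, an odd prime is `3`
or `≥ 5`; at `p ≥ 5` split on `r_an(E) ∈ {0, 1, ≥ 2}`: `r_an = 1` — certificate (1) ⇒ identity (2) at every
datum ⇒ `MissingLowerBoundAt` (3) ⇒ Eisenstein half (4); `r_an = 0` with a multiplicative prime —
`(A3)` certificate (6) ⇒ Eisenstein half (5); everything else is the residue stub (7). -/
theorem lowerHalf_of_engines
    (h1 : ∀ (W : WeierstrassCurve ℚ) [W.IsElliptic] [W.IsGloballyMinimal] (p : ℕ) [Fact p.Prime]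
      (N : ℕ) [NeZero N] (K : Type) [Field K] [NumberField K],
      5 ≤ p → ClassX7 W p → Surj W p → W.analyticRank = 1 → W.conductorNorm ℤ = N →
      IsImaginaryQuadratic K → SatisfiesHeegnerHypothesis N K → SatisfiesHeegnerHypothesis p K →
      (W.quadraticTwist (NumberField.discr K : ℚ)).analyticRank = 0 →
      OddVertexToricUnitAt W p K)
    (h2 : ∀ (W : WeierstrassCurve ℚ) [W.IsElliptic] [W.IsGloballyMinimal] (p : ℕ) [Fact p.Prime]
      (N : ℕ) [NeZero N] (K : Type) [Field K] [NumberField K]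
      (Dt : ModularParametrizationData W N) (H : HeegnerDatum N (NumberField.discr K)) (ι : K →+* ℂ)
      (P : (W.baseChange K).toAffine.Point),
      ClassX7 W p → Surj W p → 5 ≤ p → W.analyticRank = 1 → W.conductorNorm ℤ = N →
      IsImaginaryQuadratic K → SatisfiesHeegnerHypothesis N K → SatisfiesHeegnerHypothesis p K →
      WeierstrassCurve.Affine.Point.map ι.toRatAlgHom P = heegnerPointComplex Dt H →
      ¬ (p : ℤ) ∣ Dt.c → (W.quadraticTwist (NumberField.discr K : ℚ)).analyticRank = 0 →
      OddVertexToricUnitAt W p K → X11b.IndexIdentityAt W p K P)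
    (h3 : (∀ (W : WeierstrassCurve ℚ) [W.IsElliptic] [W.IsGloballyMinimal] (p : ℕ) [Fact p.Prime]
      (N : ℕ) [NeZero N] (K : Type) [Field K] [NumberField K]
      (Dt : ModularParametrizationData W N) (H : HeegnerDatum N (NumberField.discr K)) (ι : K →+* ℂ)
      (P : (W.baseChange K).toAffine.Point),
      ClassX7 W p → Surj W p → 5 ≤ p → W.analyticRank = 1 → W.conductorNorm ℤ = N →
      IsImaginaryQuadratic K → SatisfiesHeegnerHypothesis N K → SatisfiesHeegnerHypothesis p K →
      WeierstrassCurve.Affine.Point.map ι.toRatAlgHom P = heegnerPointComplex Dt H →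
      ¬ (p : ℤ) ∣ Dt.c → (W.quadraticTwist (NumberField.discr K : ℚ)).analyticRank = 0 →
      X11b.IndexIdentityAt W p K P) →
      ∀ (W : WeierstrassCurve ℚ) [W.IsElliptic] [W.IsGloballyMinimal] (p : ℕ) [Fact p.Prime],
      ClassX7 W p → Surj W p → 5 ≤ p → W.analyticRank = 1 → MissingLowerBoundAt W p)
    (h4 : ∀ (W : WeierstrassCurve ℚ) [W.IsElliptic] [W.IsGloballyMinimal] (p : ℕ) [Fact p.Prime],
      5 ≤ p → ClassX7 W p → ¬ W.HasCM → W.frobeniusTrace p = 0 → Surj W p →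
      W.analyticRank = 1 → MissingLowerBoundAt W p →
      ∃ ε : ℤˣ, KobayashiLowerDivisibility W p ε)
    (h5 : ∀ (W : WeierstrassCurve ℚ) [W.IsElliptic] [W.IsGloballyMinimal] (p : ℕ) [Fact p.Prime],
      5 ≤ p → ClassX7 W p → ¬ W.HasCM → W.frobeniusTrace p = 0 → Surj W p →
      W.analyticRank = 0 → X7.ToricPeriodUnitAt W p →
      ∃ ε : ℤˣ, KobayashiLowerDivisibility W p ε)
    (h6 : ∀ (W : WeierstrassCurve ℚ) [W.IsElliptic] [W.IsGloballyMinimal] (p : ℕ) [Fact p.Prime],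
      5 ≤ p → ClassX7 W p → ¬ W.HasCM → W.frobeniusTrace p = 0 → Surj W p →
      W.analyticRank = 0 → (∃ (ℓ : ℕ) (_ : Fact ℓ.Prime), W.HasMultiplicativeReductionAtPrime ℓ) →
      X7.ToricPeriodUnitAt W p)
    (h7 : ∀ (W : WeierstrassCurve ℚ) [W.IsElliptic] [W.IsGloballyMinimal] (p : ℕ) [Fact p.Prime],
      p ≠ 2 → ClassX7 W p → ¬ W.HasCM → W.frobeniusTrace p = 0 → Surj W p →
      (p = 3 ∨ 2 ≤ W.analyticRank ∨
        (W.analyticRank = 0 ∧ ¬ ∃ (ℓ : ℕ) (_ : Fact ℓ.Prime), W.HasMultiplicativeReductionAtPrime ℓ)) →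
      ∃ ε : ℤˣ, KobayashiLowerDivisibility W p ε) :
    ∀ (W : WeierstrassCurve ℚ) [W.IsElliptic] [W.IsGloballyMinimal] (p : ℕ) [Fact p.Prime],
      p ≠ 2 → ClassX7 W p → ¬ W.HasCM → W.frobeniusTrace p = 0 → Surj W p →
      ∃ ε : ℤˣ, KobayashiLowerDivisibility W p ε := by
  intro W _ _ p _ hp2 hX hcm hap hs
  have hpP : p.Prime := Fact.out
  by_cases hp5 : 5 ≤ p
  · rcases Nat.lt_trichotomy W.analyticRank 1 with hr | hr | hr
    · have hr0 : W.analyticRank = 0 := by omega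
      by_cases hm : ∃ (ℓ : ℕ) (_ : Fact ℓ.Prime), W.HasMultiplicativeReductionAtPrime ℓ
      · exact h5 W p hp5 hX hcm hap hs hr0 (h6 W p hp5 hX hcm hap hs hr0 hm)
      · exact h7 W p hp2 hX hcm hap hs (Or.inr (Or.inr ⟨hr0, hm⟩))
    · have hI : ∀ (W : WeierstrassCurve ℚ) [W.IsElliptic] [W.IsGloballyMinimal] (p : ℕ) [Fact p.Prime]
          (N : ℕ) [NeZero N] (K : Type) [Field K] [NumberField K]
          (Dt : ModularParametrizationData W N) (H : HeegnerDatum N (NumberField.discr K)) (ι : K →+* ℂ)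
          (P : (W.baseChange K).toAffine.Point),
          ClassX7 W p → Surj W p → 5 ≤ p → W.analyticRank = 1 → W.conductorNorm ℤ = N →
          IsImaginaryQuadratic K → SatisfiesHeegnerHypothesis N K → SatisfiesHeegnerHypothesis p K →
          WeierstrassCurve.Affine.Point.map ι.toRatAlgHom P = heegnerPointComplex Dt H →
          ¬ (p : ℤ) ∣ Dt.c → (W.quadraticTwist (NumberField.discr K : ℚ)).analyticRank = 0 →
          X11b.IndexIdentityAt W p K P :=
        fun W' _ _ p' _ N _ K _ _ Dt H ι P hX' hs' hp5' hr' hN hK hH hHp hP hc htw =>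
          h2 W' p' N K Dt H ι P hX' hs' hp5' hr' hN hK hH hHp hP hc htw
            (h1 W' p' N K hp5' hX' hs' hr' hN hK hH hHp htw)
      exact h4 W p hp5 hX hcm hap hs hr (h3 hI W p hX hs hp5 hr)
    · exact h7 W p hp2 hX hcm hap hs (Or.inr (Or.inl (by omega)))
  · have hp3 : p = 3 := by
      have h2 := hpP.two_le
      interval_cases p
      · exact absurd rfl hp2
      · rfl
      · exact absurd hpP (by decide)
    exact h7 W p hp2 hX hcm hap hs (Or.inl hp3)

/-- THE SKELETON: the crux BY NAME from exactly the seven stubs (no `sorry` of its own; the stubs' `sorry`s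
are the line's open obligations). -/
theorem KobayashiLowerHalfLargeImage_of :
    Summit.BirchSwinnertonDyer.BirchSwinnertonDyer.Theses.SignedLowerHalves.KobayashiLowerHalfLargeImage :=
  lowerHalf_of_engines stub_oddVertexCertificate_rankOne stub_indexIdentity_of_oddVertexCertificate
    stub_missingLowerBound_of_indexIdentity stub_lift_rankOne stub_rankZero_of_toricPeriodUnit
    stub_toricPeriodUnit_rankZero stub_residues

end ToricOddVertex

end Summit.BirchSwinnertonDyer.BirchSwinnertonDyer.Cruxes.KobayashiLowerHalfLargeImage

end
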